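import Summits.ValiantsHypothesis.ValiantsHypothesis.Theses.SymmetroidDescartes
import Summits.ValiantsHypothesis.ValiantsHypothesis.Theorems.MatrixDescartes.Negative.MatrixDescartesFalseOfTropicalMonster
import Summits.ValiantsHypothesis.ValiantsHypothesis.Theorems.LacunarySymmetroidPencilTransfer

/-!
# `LacunaryDescartes` — negative lemma modulo `TropicalMonsterLD` (tropical door for the alternation count)

Crux `stmt-ValiantsHypothesis-18501` (`Theses.SymmetroidDescartes.LacunaryDescartes`, LD: a real SYMMETRIC
lacunary pencil `∑ₗ X^{dₗ} Sₗ` with `K` terms and size `m ≤ 2^{c(⌊log₂K⌋+1)²}` has at most `K^{bK}` strict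
sign alternations of `det` along increasing positive test points, `b` uniform in `c`).  Transfer audit of the
merged cell `route-ValiantsHypothesis-SymmetroidDescartes` (glue `quasiRolleToDescartes_proof`:
`DerivedPencilRolleQuasi → LacunaryDescartes`): this file gives LD the same VH-neutral SEPARATING FAMILY the
sibling crux `MatrixDescartes` has (`MatrixDescartes_false_of_TropicalMonster`, p164927) —

  `LacunaryDescartes_false_of_TropicalMonsterLD : TropicalMonsterLD → ¬ LacunaryDescartes`.

Two points are specific to the alternation currency of LD:

* **LD is symmetry-free for alternations, but not by doubling.**  The symmetric doubling
  `T ↦ [[0,P],[Pᵀ,1]]` used for MDR (`matrixDescartes_iff_general`) squares the determinant and kills every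
  sign alternation.  Instead `exists_symm_pencil_det_eq` realises the determinant of an ARBITRARY real
  `K`-term pencil of size `m` EXACTLY (as a polynomial in `X`) as the determinant of a symmetric
  `(K+1)`-term pencil of size `4m³ + 7` with exponents `0, d₀, …, d_{K−1}`: the linear matrix `∑ₗ yₗ Tₗ` is an
  affine determinantal representation of its own determinant, Grenet–Kaltofen–Koiran–Portier 2011 Thm. 5
  (tree theorem `GKKP2011_detPoly_symmetric_holds`, via `hasSymmAffineDetRepr_of_hasDetRepr`) symmetrises
  it exactly, and `pencilDet_of_affine` restricts it to the monomial curve as a polynomial identity.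
  Consequence for provers: a proof of LD may not use self-adjointness in any essential way either.
* **Patchworked designs give alternations directly** (`det_patch_alternates`, tree): `B + 1` integer slopes
  with unique optima of alternating sign are `B` strict sign alternations of `det` at the positive,
  strictly increasing test points `b^{θₖ}`.

`TropicalMonsterLD` (construction target, NOT claimed; thresholds pre-shifted to the symmetrised format
`(4m³+7, K+1)` so that the door is bookkeeping-free): for every `b` some regime `c` carries, for infinitely
many `K`, a general-pencil tropical design of format `(m, K)` with more than `(K+1)^{b(K+1)}` alternating
unique optima.  As for MDR this is finite polyhedral combinatorics (K-slope-class parametric assignment,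
2-D shadows of Birkhoff polytopes; Hrubeš–Yehudayoff 2021 Prop. 23 and Open Problem 1), says nothing about
`VP` vs `VNP`, and is open: required breakpoint exponent `e(K) = log_m B ≳ bK log K / (c log²K)` for every
`b`, i.e. `e(K)/ (K / log K) → ∞`; known `e(2) = 1`, `e(3) = 2`, Gusfield-type designs `2^{O(log² m)}`.

[topic AlgebraicComplexity/RealTauConjecture] [folklore] Viro patchworking; GKKP symmetrisation.
-/

-- `Summit.ValiantsHypothesis.ValiantsHypothesis.…` repeats a component by the D-0017 layout
-- (single-conjunct summit), which the `dupNamespace` linter flags; the name is mandated.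
set_option linter.dupNamespace false

namespace Summit.ValiantsHypothesis.ValiantsHypothesis.Theorems.LacunaryDescartes.Negative

open Summit.ValiantsHypothesis.ValiantsHypothesis.Theses.SymmetroidDescartes (LacunaryDescartes)
open Summit.ValiantsHypothesis.ValiantsHypothesis.Theorems.MatrixDescartes.Negative
open Literature.Computability.AlgebraicComplexity
open scoped BigOperators Matrix
open Polynomial

section SymmetryFree

variable {m K : ℕ}

/-- The linear matrix `∑ₗ yₗ • Tₗ` over `ℝ[y₀,…,y_{K−1}]` of a real `K`-term pencil. -/
noncomputable def linMat (T : Fin K → Matrix (Fin m) (Fin m) ℝ) :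
    Matrix (Fin m) (Fin m) (MvPolynomial (Fin K) ℝ) :=
  ∑ l, (MvPolynomial.X l : MvPolynomial (Fin K) ℝ) •
    (T l).map (fun a : ℝ => (MvPolynomial.C a : MvPolynomial (Fin K) ℝ))

/-- The entries of the linear matrix are linear forms (total degree `≤ 1`). [folklore] -/
theorem totalDegree_linMat_le (T : Fin K → Matrix (Fin m) (Fin m) ℝ) (i j : Fin m) :
    (linMat T i j).totalDegree ≤ 1 := by
  unfold linMat
  simp only [Matrix.sum_apply, Matrix.smul_apply, Matrix.map_apply, smul_eq_mul]
  refine (MvPolynomial.totalDegree_finsetSum _ _).trans (Finset.sup_le fun l _ => ?_)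
  calc (MvPolynomial.X l * MvPolynomial.C (T l i j) : MvPolynomial (Fin K) ℝ).totalDegree
      ≤ (MvPolynomial.X l : MvPolynomial (Fin K) ℝ).totalDegree
          + (MvPolynomial.C (T l i j) : MvPolynomial (Fin K) ℝ).totalDegree :=
        MvPolynomial.totalDegree_mul _ _
    _ ≤ 1 + 0 := add_le_add (MvPolynomial.totalDegree_X (R := ℝ) l).le (by rw [MvPolynomial.totalDegree_C])
    _ = 1 := rfl

/-- Restricting the linear matrix to the monomial curve `yₗ := X^{dₗ}` gives back the pencil. [folklore] -/
theorem aeval_mapMatrix_linMat (T : Fin K → Matrix (Fin m) (Fin m) ℝ) (d : Fin K → ℕ) :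
    (MvPolynomial.aeval fun l => (X : ℝ[X]) ^ d l).mapMatrix (linMat T) =
      ∑ l, (X : ℝ[X]) ^ d l • (T l).map Polynomial.C := by
  ext a c
  simp only [linMat, AlgHom.mapMatrix_apply, Matrix.map_apply, Matrix.sum_apply, Matrix.smul_apply,
    smul_eq_mul, map_sum, map_mul, MvPolynomial.aeval_X, MvPolynomial.aeval_C,
    Polynomial.algebraMap_apply, Algebra.algebraMap_self, RingHom.id_apply]

/-- **LD is symmetry-free (exact symmetrisation).**  The determinant of an arbitrary real `K`-term
lacunary pencil of size `m` is, as a polynomial, the determinant of a real SYMMETRIC `(K+1)`-term pencil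
of size `4m³ + 7` with exponents `0, d₀, …, d_{K−1}` (GKKP 2011 Thm. 5 applied to the linear matrix
`∑ₗ yₗ Tₗ`, then restricted to the monomial curve). -/
theorem exists_symm_pencil_det_eq (T : Fin K → Matrix (Fin m) (Fin m) ℝ) (d : Fin K → ℕ) :
    ∃ S : Fin (K + 1) → Matrix (Fin (4 * m ^ 3 + 7)) (Fin (4 * m ^ 3 + 7)) ℝ, (∀ l, (S l).IsSymm) ∧
      (∑ l, (X : ℝ[X]) ^ (Fin.cons (α := fun _ => ℕ) (0 : ℕ) d l) • (S l).map Polynomial.C).det =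
        (∑ l, (X : ℝ[X]) ^ d l • (T l).map Polynomial.C).det := by
  have hf : HasDetRepr (linMat T).det m := ⟨linMat T, totalDegree_linMat_le T, rfl⟩
  obtain ⟨B, hBsymm, hB⟩ :=
    Summit.ValiantsHypothesis.ValiantsHypothesis.Theorems.SymmetroidDescartes.hasSymmAffineDetRepr_of_hasDetRepr
      (k := ℝ) two_ne_zero hf
  refine ⟨Fin.cons (constPart B) (fun i => LRPencil.coeffMat B i), ?_, ?_⟩
  · refine Fin.cases ?_ (fun i => ?_)
    · rw [Fin.cons_zero]; exact hBsymm.map _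
    · rw [Fin.cons_succ]; exact hBsymm.map _
  · rw [Summit.ValiantsHypothesis.ValiantsHypothesis.Theorems.LacunarySymmetroid.pencilDet_of_affine B hB.1 d,
      hB.2, AlgHom.map_det, aeval_mapMatrix_linMat]

end SymmetryFree

/-- **`TropicalMonsterLD`** (construction target, NOT claimed): for every exponent `b` there is a size
regime `c` such that for infinitely many `K` some tropical design for a GENERAL real pencil of format
`(m, K)` — exponents `d`, integer valuations `v`, signs `ε ∈ {−1,0,1}` — has `B + 1` strictly increasing
integer slopes with unique Leibniz optima of alternating sign, where `B > (K+1)^{b(K+1)}` and the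
symmetrised size `4m³ + 7` lies in regime `c` at `K + 1` terms.  (The shifts `m ↦ 4m³+7`, `K ↦ K+1` are
the cost of exact symmetrisation and are immaterial for any asymptotic construction.) -/
def TropicalMonsterLD : Prop :=
  ∀ b : ℕ, ∃ c : ℕ, ∀ K₀ : ℕ, ∃ K m : ℕ, K₀ ≤ K ∧
    4 * m ^ 3 + 7 ≤ 2 ^ (c * (Nat.log 2 (K + 1) + 1) ^ 2) ∧
    ∃ (d : Fin K → ℕ) (v ε : Fin m → Fin m → Fin K → ℤ) (B : ℕ) (θ : Fin (B + 1) → ℤ)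
      (p : Fin (B + 1) → Equiv.Perm (Fin m) × (Fin m → Fin K)),
      (∀ i j l, (ε i j l).natAbs ≤ 1) ∧ StrictMono θ ∧ (∀ k, IsDominant d v ε (θ k) (p k)) ∧
      (∀ k : Fin B, termSign ε (p k.castSucc) * termSign ε (p k.succ) < 0) ∧
      (K + 1) ^ (b * (K + 1)) < B

/-- **Negative lemma modulo `TropicalMonsterLD`.**  A family of tropical designs with super-`K^{bK}`
alternating unique optima for every `b`, in some quasi-polynomial size regime, refutes `LacunaryDescartes`:
patchwork the design (`det_patch_alternates`), symmetrise exactly (`exists_symm_pencil_det_eq`), and feed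
the `B` strict sign alternations at the test points `b₀^{θₖ}` to LD at `K + 1` terms. -/
theorem LacunaryDescartes_false_of_TropicalMonsterLD (hT : TropicalMonsterLD) : ¬ LacunaryDescartes := by
  rintro ⟨b, hb⟩
  obtain ⟨c, hc⟩ := hT b
  obtain ⟨K₀, hK⟩ := hb c
  obtain ⟨K, m, hK₀, hm, d, v, ε, B, θ, p, hε, hθ, hdom, halt, hB⟩ := hc K₀
  -- base of the patchworking
  set b₀ : ℝ := (Fintype.card (Equiv.Perm (Fin m) × (Fin m → Fin K)) : ℝ) + 1 with hb₀def
  have hb₀ : (Fintype.card (Equiv.Perm (Fin m) × (Fin m → Fin K)) : ℝ) < b₀ := by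
    rw [hb₀def]; linarith
  have hb1 : 1 < b₀ := by
    have : (1 : ℝ) ≤ Fintype.card (Equiv.Perm (Fin m) × (Fin m → Fin K)) := by
      exact_mod_cast (Fintype.card_pos_iff.mpr ⟨p 0⟩ :
        0 < Fintype.card (Equiv.Perm (Fin m) × (Fin m → Fin K)))
    linarith
  have hb0 : 0 < b₀ := lt_trans zero_lt_one hb1
  -- exact symmetrisation of the patchworked pencil
  obtain ⟨S, hS, hdet⟩ := exists_symm_pencil_det_eq (patchMatrix b₀ v ε) d
  -- test points
  let τ : Fin (B + 1) → ℝ := fun k => b₀ ^ θ k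
  have hτmono : StrictMono τ := fun i j hij => zpow_lt_zpow_right₀ hb1 (hθ hij)
  have hτpos : ∀ k, 0 < τ k := fun k => zpow_pos hb0 _
  have h := hK (K + 1) (by omega) (4 * m ^ 3 + 7) hm S (Fin.cons (α := fun _ => ℕ) (0 : ℕ) d) hS B τ
    hτmono hτpos (fun k => by
      rw [hdet, Summit.ValiantsHypothesis.ValiantsHypothesis.Theorems.SymmetroidDescartes.eval_det_pencil,
        Summit.ValiantsHypothesis.ValiantsHypothesis.Theorems.SymmetroidDescartes.eval_det_pencil]
      exact det_patch_alternates b₀ d v ε hε θ p hdom halt hb₀ k)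
  exact absurd h (not_le.mpr hB)

end Summit.ValiantsHypothesis.ValiantsHypothesis.Theorems.LacunaryDescartes.Negative
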